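import Summits.BirchSwinnertonDyer.BirchSwinnertonDyer.Theorems.CMKolyvaginAtInertTwoGenusTrivialityCoreAtTwo
import Summits.BirchSwinnertonDyer.BirchSwinnertonDyer.Theorems.CMKolyvaginAtInertTwoGenusTrivialityRingClassAtTwo
import Summits.BirchSwinnertonDyer.BirchSwinnertonDyer.Theorems.GenusKolyvaginAtTwoVisiblePairAtTwoKolyvaginClassSign
import Summits.BirchSwinnertonDyer.BirchSwinnertonDyer.Theorems.GenusKolyvaginAtTwoEquivariantKolyvaginExactAtTwoArchimedeanVanishingNegDisc
import Summits.BirchSwinnertonDyer.Rank1Residual.P2.CMKolyvaginRationalDescentPlumbingAtTwo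
import Literature.NumberTheory.EllipticCurves.SelmerTorsionRestriction
import Literature.NumberTheory.EllipticCurves.SerreOpenImageOrdinaryInertiaProofs
import Literature.NumberTheory.EllipticCurves.SelmerCorankControlRatProofs
import HarnessLib

/-!
# Route `CMKolyvaginAtInertTwo`, crux `CMKolyvaginExactAtInertTwo` (stmt-BirchSwinnertonDyer-24277) —
# GENUS TRIVIALITY, FILE 3: A `W`-SIDE DEEP KOLYVAGIN CLASS DESCENDS TO AN HONEST `ℚ`-SELMER CLASS

Seat `bsd-line-cmk2-p1` g20 (cell `bsd-print-cf2`), `--supports stmt-BirchSwinnertonDyer-24277` (helper;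
closes nothing).  THEOREMS ONLY (no definition, no named fact, no `sorry`).  BSD is NOT proved by this.

On the frame of 24277 (`W/ℚ` globally minimal, `Δ_W < 0`, `ρ̄_{E,2}` onto; `K` imaginary quadratic, `d_K`
odd `≠ −3`, Heegner; `(Dt, β, ι)`), for a square-free `n` of Zhang–Kolyvagin primes at `2` of index
`≥ M + 1` (ONE LEVEL DEEPER than the class) and a datum `d` at `n` of Kolyvagin sign `+1` whose class
`c_M(n)` is Selmer at the finite places of `K`, there is `κ ∈ H¹(ℚ, E[2^M])` Selmer at every place of
`ℚ` with `res_K κ = c_M(n)` (`exists_selmer_resTorsion_eq_kolyvaginClass_two_of_sign_one`).  §1 the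
dictionary `θ = RatClosure.pointsEquiv` and (desc-fin) off `d_K`; §2 the `Γ_ℚ`-side admissible pair
`(θ⁻¹E(K[n]), θ⁻¹P(n))`; §3 Gross 5.4 (1) at `2` with sign `+1` for every lift, McCallum's class over
`Γ_ℚ`, `res_K` by `map_cls`, Selmer at `q ∣ d_K` by the genus triviality criterion (files 1–2).
Consumer: the `W`-rungs of gk2's twin ladder with `x_i ∈ Ш(W/ℚ)` proper (`β₊ = 0` in the defect-rank
frame) — the lower half of 24277 for composite `d_K` (memo `Cruxes/CMExactDescentAtTwo/MEMO-genus-triviality.md`).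

References: [GrossLMS1991] Prop. 3.6, §4 (4.2)–(4.6), Lemma 4.3, Prop. 5.3, 5.4, 6.2 (1); [McCallumLMS1991]
§4 (4)–(6), Lemma 4.1, 4.3; [Cox2013] Lemma 9.3; [MilneADT2006] I.3.8, I.§6.
-/

set_option autoImplicit false
-- the Theorems namespace of this sub repeats the summit name by design (D-0017 nested layout)
set_option linter.dupNamespace false

noncomputable section

open scoped Classical NumberField Pointwise

namespace Summit.BirchSwinnertonDyer.BirchSwinnertonDyer.Theorems.KolyvaginGenusTwo

open NumberField IsDedekindDomain Field WeierstrassCurve Rat.HeightOneSpectrum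
open Literature.NumberTheory.EllipticCurves Literature.NumberTheory.EllipticCurves.RingClassField
open Literature.NumberTheory.GaloisRepresentations Literature.NumberTheory.EllipticCurves.ModularForms
open Literature.NumberTheory.EllipticCurves.KolyvaginCocycle
open Summit.BirchSwinnertonDyer.Rank1Residual.X11b Summit.BirchSwinnertonDyer.Rank1Residual.X11b.Three
open Summit.BirchSwinnertonDyer.Rank1Residual.X11b.KolyvaginTauEigen
open Summit.BirchSwinnertonDyer.Rank1Residual.JET
open Summit.BirchSwinnertonDyer.Rank1Residual.P2

variable {K : Type} [Field K] [NumberField K] (W : WeierstrassCurve ℚ)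

/-! ## §1 The dictionary `θ = RatClosure.pointsEquiv` and (desc-fin) off `d_K` -/

/-- The coefficient map of `resTorsion W K n` on points IS `θ = RatClosure.pointsEquiv` (both apply the chosen
embedding `ℚ̄ → K̄` to the coordinates). [folklore] -/
theorem localPointsEquivGeomPoints_pointsMap_eq_pointsEquiv (P : W.geomPoints) :
    localPointsEquivGeomPoints W K (pointsMap W K P) = RatClosure.pointsEquiv (K := K) W P := by
  change (W.baseChange (AlgebraicClosure ℚ)).toAffine.Point at P
  rcases P with _ | ⟨x, y, h⟩
  · exact (map_zero _).trans (map_zero _).symm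
  · rfl

variable {W} in
/-- **(desc-fin) OFF `d_K`, any `d_K`**: for `v` with `p_v ∤ d_K`, a class of `H¹(ℚ, E[m])` whose restriction
to `K` is Selmer at every `w ∣ v` is Selmer at `v` (ty2's `hdescfin_of_heegner_prime_discr`, whose only use
of «`d_K = −q`» is `p_v ∤ d_K`). [cite: MilneADT2006, Ch. I Prop. 3.8 and §6] [cite: GrossLMS1991, §1] -/
theorem hdescfin_of_not_dvd_discr [W.IsElliptic] (hK : IsImaginaryQuadratic K)
    (hH : SatisfiesHeegnerHypothesis (W.conductorNorm ℤ) K) (m : ℤ) (ξ : galH1Torsion W m)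
    (v : HeightOneSpectrum (𝓞 ℚ)) (hnd : ¬ ((primesEquiv v : ℕ) : ℤ) ∣ NumberField.discr K)
    (hξ : ∀ w : HeightOneSpectrum (𝓞 K), w.under (𝓞 ℚ) = v →
      resTorsion W K m ξ ∈ selmerLocalKer (W.baseChange K) (w.adicCompletion K) m) :
    ξ ∈ selmerLocalKer W (v.adicCompletion ℚ) m := by
  have h2 : Module.finrank ℚ K = 2 := hK.1
  obtain ⟨θ, c, hθnot, hθ⟩ := Literature.NumberTheory.QuadraticFields.Quadratic.exists_sq_eq_algebraMap h2
  have hL := Literature.NumberTheory.QuadraticFields.Quadratic.exists_eq_add_mul h2 hθnot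
  haveI : Algebra.IsQuadraticExtension ℚ K := ⟨h2⟩
  haveI : IsGalois ℚ K := inferInstance
  have hunr : Algebra.IsUnramifiedIn (𝓞 K) v.asIdeal := RationalDescentPlumbing.isUnramifiedIn_of_not_dvd_discr v hnd
  refine RationalDescentPlumbing.mem_selmerLocalKer_of_forall_under W m v (fun w _ x hx ↦ ?_) hξ
  by_cases hgood : W.HasGoodReductionAt v
  · exact mem_localRestrictionKer_adicCompletion_of_isUnramifiedIn W K hθ hL hgood hunr w hx
  · have hdvd : (primesEquiv v : ℕ) ∣ W.conductorNorm ℤ := (W.dvd_conductorNorm_iff v).mpr hgood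
    have hsplit : (v.asIdeal.primesOver (𝓞 K)).ncard = Module.finrank ℚ K := by
      rw [← RationalDescentPlumbing.primesOver_span_eq_primesOver_asIdeal v rfl, hH _ (primesEquiv v).2 hdvd, h2]
    exact mem_localRestrictionKer_adicCompletion_of_ncard_primesOver_eq W K hθ hL hsplit w hx

/-! ## §2 The `Γ_ℚ`-side admissible pair `(θ⁻¹E(K[n]), θ⁻¹P(n))` -/

section RatSide

variable {W}
variable {N : ℕ} [NeZero N] {Dt : ModularParametrizationData W N} {β : ℤ} {ι : K →+* ℂ} {n : ℕ}

/-- **`θ⁻¹E(K[n]) ⊆ E(ℚ̄)` is `Γ_ℚ`-admissible** when `E(K[n]) ⊆ E(K̄)` is `Γ_K`-admissible: every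
`γ ∈ Γ_ℚ` acts through `θ` as a lift of an automorphism of `K` (`RatClosure.pointsEquiv_smul_of_lift`),
under which `E(K[n])` is stable (x11b3 `RingClassConj.pointsMap_mem_pointsSubgroup`).
[cite: GrossLMS1991, §4 Lemma 4.3 and (4.2)] [cite: Cox2013, §9.A Lemma 9.3] -/
theorem isAdmissible_comap_pointsEquiv (hK : IsImaginaryQuadratic K) (hn : n ≠ 0)
    (d : KolyvaginHeegnerData Dt β ι n) {m : ℤ}
    (hA : IsAdmissible (absoluteGaloisGroup K) d.pointsSubgroup m) :
    IsAdmissible (absoluteGaloisGroup ℚ)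
      (d.pointsSubgroup.comap (RatClosure.pointsEquiv (K := K) W).toAddMonoidHom) m where
  smul_mem g a ha := by
    haveI : Algebra.IsQuadraticExtension ℚ K := ⟨hK.1⟩
    rw [AddSubgroup.mem_comap] at ha ⊢
    change RatClosure.pointsEquiv (K := K) W (g • a) ∈ d.pointsSubgroup
    rw [RatClosure.pointsEquiv_smul_of_lift W
      (RatClosure.isLiftOfAut_restrictNormal_absGaloisTransport (L := K) g) g (fun _ ↦ rfl) a]
    exact RingClassConj.pointsMap_mem_pointsSubgroup hK hn d _ _ ha
  eq_zero_of_zsmul a ha h0 := by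
    rw [AddSubgroup.mem_comap] at ha
    have h1 : m • RatClosure.pointsEquiv (K := K) W a = 0 := by
      rw [← map_zsmul, h0, map_zero]
    have h2 := hA.eq_zero_of_zsmul ha h1
    exact (RatClosure.pointsEquiv (K := K) W).injective (h2.trans (map_zero _).symm)

/-- **`θ⁻¹P(n)` is `Γ_ℚ`-invariant modulo `m·θ⁻¹E(K[n])`** when `P(n)` is `Γ_K`-invariant modulo `m·E(K[n])`
and every lift `τ` of the non-trivial automorphism of `K` has `τP(n) = P(n) + m·B`, `B ∈ E(K[n])`:
`γ ∈ Γ_ℚ` either restricts trivially to `K` (then `γ ∈ res Γ_K`, `mem_range_absGaloisRestrict_iff`) or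
`e γ e⁻¹` is such a lift. [cite: GrossLMS1991, Prop. 3.6, §4 (4.1), Prop. 5.4 (1)] [cite: McCallumLMS1991, §4 (4)] -/
theorem mem_invPoints_comap_pointsEquiv (hK : IsImaginaryQuadratic K)
    (d : KolyvaginHeegnerData Dt β ι n) {m : ℤ}
    (hP : d.toGeomPoints d.derivedPoint ∈ invPoints (absoluteGaloisGroup K) d.pointsSubgroup m)
    (hsign : ∀ (c : K ≃ₐ[ℚ] K), c ≠ 1 → ∀ (τ : AlgebraicClosure K ≃+* AlgebraicClosure K)
      (hτ : IsLiftOfAut c τ), ∃ B ∈ d.pointsSubgroup,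
        hτ.pointsMap W (d.toGeomPoints d.derivedPoint) = d.toGeomPoints d.derivedPoint + m • B) :
    (RatClosure.pointsEquiv (K := K) W).symm (d.toGeomPoints d.derivedPoint) ∈
      invPoints (absoluteGaloisGroup ℚ)
        (d.pointsSubgroup.comap (RatClosure.pointsEquiv (K := K) W).toAddMonoidHom) m := by
  haveI : Algebra.IsQuadraticExtension ℚ K := ⟨hK.1⟩
  refine ⟨?_, fun γ ↦ ?_⟩
  · rw [AddSubgroup.mem_comap]
    change RatClosure.pointsEquiv (K := K) W ((RatClosure.pointsEquiv (K := K) W).symm _) ∈ _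
    rw [AddEquiv.apply_symm_apply]
    exact hP.1
  · have hτ := RatClosure.isLiftOfAut_restrictNormal_absGaloisTransport (K := ℚ) (L := K) γ
    have hθγ : RatClosure.pointsEquiv (K := K) W
        (γ • (RatClosure.pointsEquiv (K := K) W).symm (d.toGeomPoints d.derivedPoint)) =
        hτ.pointsMap W (d.toGeomPoints d.derivedPoint) := by
      rw [RatClosure.pointsEquiv_smul_of_lift W hτ γ (fun _ ↦ rfl), AddEquiv.apply_symm_apply]
    obtain ⟨RK, hRK, hRKe⟩ : ∃ RK ∈ d.pointsSubgroup,
        m • RK = hτ.pointsMap W (d.toGeomPoints d.derivedPoint) - d.toGeomPoints d.derivedPoint := by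
      by_cases hc : (absGaloisTransport (K := ℚ) (L := K) γ).restrictNormal K = 1
      · -- `γ` restricts trivially to `K`: it is `res g'` for some `g' ∈ Γ_K`
        have hγ : γ ∈ Set.range (absGaloisRestrict ℚ K) := by
          rw [mem_range_absGaloisRestrict_iff]
          intro x
          have h := AlgEquiv.restrictNormal_commutes (absGaloisTransport (K := ℚ) (L := K) γ) K x
          rw [hc, AlgEquiv.one_apply] at h
          exact h.symm
        obtain ⟨g', hg'⟩ := hγ
        obtain ⟨R, hR, hRe⟩ := hP.2 g'
        refine ⟨R, hR, ?_⟩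
        have hg'P : g' • d.toGeomPoints d.derivedPoint = hτ.pointsMap W (d.toGeomPoints d.derivedPoint) := by
          rw [← hθγ, ← hg', RatClosure.pointsEquiv_smul, AddEquiv.apply_symm_apply]
        rw [hRe, hg'P]
      · obtain ⟨B, hB, hBe⟩ := hsign _ hc _ hτ
        exact ⟨B, hB, by rw [hBe]; abel⟩
    refine ⟨(RatClosure.pointsEquiv (K := K) W).symm RK, ?_, ?_⟩
    · rw [AddSubgroup.mem_comap]
      change RatClosure.pointsEquiv (K := K) W ((RatClosure.pointsEquiv (K := K) W).symm RK) ∈ _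
      rw [AddEquiv.apply_symm_apply]
      exact hRK
    · apply (RatClosure.pointsEquiv (K := K) W).injective
      rw [map_zsmul, AddEquiv.apply_symm_apply, hRKe, map_sub, hθγ, AddEquiv.apply_symm_apply]

end RatSide

/-! ## §3 Gross 5.4 (1) at `2` with sign `+1` for every lift, and the `ℚ`-Selmer descent -/

section Descent

variable {W}
variable [W.IsElliptic] [W.IsGloballyMinimal] [NeZero (W.conductorNorm ℤ)]

/-- **Gross 1991 Prop. 5.4 (1) AT `2`, SIGN `+1`, FOR EVERY LIFT** `τ` to `K̄` of the non-trivial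
automorphism of `K`: `τ P(n) = P(n) + 2^M B`, `B ∈ E(K[n])` (JET `pointsMap_derivedPoint_concrete_of_prop53_zhang`
with Prop. 5.3 unconditional at every divisor and Lemma 4.3 at `2`, as in gk2-p3's `sign_conjAct_kolyvaginClass_two`).
[cite: GrossLMS1991, §5 Prop. 5.3, Prop. 5.4 (1) (p. 243), §4 Lemma 4.3] [cite: McCallumLMS1991, §5 (p. 303)] -/
theorem exists_pointsMap_derivedPoint_eq_add_two_pow_smul_of_sign_one (hK : IsImaginaryQuadratic K)
    (hodd : Odd (NumberField.discr K)) (h3 : NumberField.discr K ≠ -3)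
    (hH : SatisfiesHeegnerHypothesis (W.conductorNorm ℤ) K) (hsurj : W.HasSurjectiveModNGaloisRep ((2 : ℤ) ^ 1))
    (Dt : ModularParametrizationData W (W.conductorNorm ℤ)) (β : ℤ) (ι : K →+* ℂ)
    {n M : ℕ} (hn : Squarefree n) (hM : 1 ≤ M)
    (hkol : ∀ q ∈ n.primeFactors, Zhang2014.IsKolyvaginPrime (W.conductorNorm ℤ) W K 2 q ∧
      M ≤ Zhang2014.kolyvaginIndex W 2 q)
    (d : KolyvaginHeegnerData Dt β ι n) (hsign : -W.rootNumber * (-1) ^ n.primeFactors.card = 1)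
    {c : K ≃ₐ[ℚ] K} (hc : c ≠ 1) {τ : AlgebraicClosure K ≃+* AlgebraicClosure K} (hτ : IsLiftOfAut c τ) :
    ∃ B ∈ d.pointsSubgroup, hτ.pointsMap W (d.toGeomPoints d.derivedPoint) =
      d.toGeomPoints d.derivedPoint + ((2 ^ M : ℕ) : ℤ) • B := by
  have hD4 : NumberField.discr K ≠ -4 := fun h ↦ by
    rw [h] at hodd; exact (Int.not_even_iff_odd.mpr hodd) ⟨-2, by norm_num⟩
  have hCM1 : phi_heegnerPointOfConductor_mem_range_map_ringClassField (W.conductorNorm ℤ) W K :=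
    phi_heegnerPointOfConductor_mem_range_map_ringClassField_holds (W.conductorNorm ℤ) W K
  have hCM2 : exists_generator_ringClassGalOver K := exists_generator_ringClassGalOver_holds
  have hND : IsCoprime (W.conductorNorm ℤ : ℤ) (NumberField.discr K) :=
    KolyvaginAssembly.isCoprime_discr_of_satisfiesHeegnerHypothesis hK hH
  have hD : NumberField.discr K < -4 := KolyvaginAssembly.discr_lt_neg_four hK ⟨h3, hD4⟩
  have hinert : ∀ (m' : ℕ), m' ∣ n → ∀ q ∈ m'.primeFactors, (Ideal.span {(q : 𝓞 K)}).IsPrime :=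
    fun m' hm' q hq ↦ (hkol q (Nat.primeFactors_mono hm' hn.ne_zero hq)).1.2.2.2.2.1
  have hne : ∀ m' : ℕ, m' ∣ n → Nonempty (KolyvaginHeegnerData Dt β ι m') := fun m' hm' ↦
    BirchSwinnertonDyer.Theorems.nonempty_kolyvaginHeegnerData_of_grossCM hCM1 hCM2 hK hH Dt β ι
      d.dvd_sq_sub (hn.squarefree_of_dvd hm') (hinert m' hm')
  let data : (m' : ℕ) → m' ∣ n → KolyvaginHeegnerData Dt β ι m' := fun m' hm' ↦
    if h : m' = n then h ▸ d else (hne m' hm').some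
  have hdata : data n dvd_rfl = d := by simp [data]
  have h53 : ∀ (m : ℕ) (hm : m ∣ n) (τm : ringClassField K ι m ≃ₐ[ℚ] ringClassField K ι m),
      (∀ x : ringClassField K ι m, ((τm x : ringClassField K ι m) : ℂ) = starRingEnd ℂ x) →
      ∃ σ' ∈ ringClassGal ι m, IsOfFinAddOrder
        (pointGalHom W (ringClassField K ι m) τm (data m hm).y -
          (-W.rootNumber) • pointGalHom W (ringClassField K ι m) σ' (data m hm).y) := by
    intro m hm τm hτm
    obtain ⟨hm0, hmN⟩ := ne_zero_and_coprime_of_isKolyvaginPrime (K := K) (hn.squarefree_of_dvd hm)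
      (fun q hq ↦ (hkol q (Nat.primeFactors_mono hm hn.ne_zero hq)).1)
    exact exists_mem_ringClassGal_isOfFinAddOrder_conj_sub_smul W hK hH Dt ι hm0 hmN (data m hm) τm hτm
  have h := pointsMap_derivedPoint_concrete_of_prop53_zhang (c := c) hK ι Nat.prime_two hM Dt hND hD hn hkol
    data hc hτ (-W.rootNumber) h53
    (fun m hm ↦ GenusKoly.isAdmissible_pointsSubgroup_two hK hodd hH hsurj
      (ne_zero_of_dvd_ne_zero hn.ne_zero hm) (data m hm) M) n dvd_rfl
  rw [hdata, hsign, one_smul] at h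
  exact h

end Descent

section Main

variable {W}
variable [W.IsElliptic] [W.IsGloballyMinimal] [NeZero (W.conductorNorm ℤ)]

/-- **Gross Prop. 3.6 / McCallum (4) at `2` for ONE datum**: `P(n)` is `Γ_K`-invariant modulo `2^{M'}E(K[n])`
when every prime of `n` has index `≥ M'` (`KolyCert.toGeomPoints_derivedPoint_mem_invPoints_of_dvd_zhang` at the top
of a tower completed around `d`). [cite: GrossLMS1991, Prop. 3.6, §4 (4.1)] [cite: McCallumLMS1991, §4 (4)] -/
theorem toGeomPoints_derivedPoint_mem_invPoints_two (hK : IsImaginaryQuadratic K)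
    (hodd : Odd (NumberField.discr K)) (h3 : NumberField.discr K ≠ -3)
    (hH : SatisfiesHeegnerHypothesis (W.conductorNorm ℤ) K)
    (Dt : ModularParametrizationData W (W.conductorNorm ℤ)) (β : ℤ) (ι : K →+* ℂ)
    {n M' : ℕ} (hn : Squarefree n)
    (hkol : ∀ q ∈ n.primeFactors, Zhang2014.IsKolyvaginPrime (W.conductorNorm ℤ) W K 2 q ∧
      M' ≤ Zhang2014.kolyvaginIndex W 2 q)
    (d : KolyvaginHeegnerData Dt β ι n) :
    d.toGeomPoints d.derivedPoint ∈ invPoints (absoluteGaloisGroup K) d.pointsSubgroup ((2 ^ M' : ℕ) : ℤ) := by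
  have hD4 : NumberField.discr K ≠ -4 := fun h ↦ by
    rw [h] at hodd; exact (Int.not_even_iff_odd.mpr hodd) ⟨-2, by norm_num⟩
  have hCM1 : phi_heegnerPointOfConductor_mem_range_map_ringClassField (W.conductorNorm ℤ) W K :=
    phi_heegnerPointOfConductor_mem_range_map_ringClassField_holds (W.conductorNorm ℤ) W K
  have hCM2 : exists_generator_ringClassGalOver K := exists_generator_ringClassGalOver_holds
  have hND : IsCoprime (W.conductorNorm ℤ : ℤ) (NumberField.discr K) :=
    KolyvaginAssembly.isCoprime_discr_of_satisfiesHeegnerHypothesis hK hH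
  have hD : NumberField.discr K < -4 := KolyvaginAssembly.discr_lt_neg_four hK ⟨h3, hD4⟩
  have hinert : ∀ (m' : ℕ), m' ∣ n → ∀ q ∈ m'.primeFactors, (Ideal.span {(q : 𝓞 K)}).IsPrime :=
    fun m' hm' q hq ↦ (hkol q (Nat.primeFactors_mono hm' hn.ne_zero hq)).1.2.2.2.2.1
  have hne : ∀ m' : ℕ, m' ∣ n → Nonempty (KolyvaginHeegnerData Dt β ι m') := fun m' hm' ↦
    BirchSwinnertonDyer.Theorems.nonempty_kolyvaginHeegnerData_of_grossCM hCM1 hCM2 hK hH Dt β ι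
      d.dvd_sq_sub (hn.squarefree_of_dvd hm') (hinert m' hm')
  let data : (m' : ℕ) → m' ∣ n → KolyvaginHeegnerData Dt β ι m' := fun m' hm' ↦
    if h : m' = n then h ▸ d else (hne m' hm').some
  have hdata : data n dvd_rfl = d := by simp [data]
  have h := Three.KolyCert.toGeomPoints_derivedPoint_mem_invPoints_of_dvd_zhang hK ι Dt Nat.prime_two
    hND hD hn hkol data n dvd_rfl
  rwa [hdata] at h

/-- **A `W`-SIDE DEEP KOLYVAGIN CLASS DESCENDS TO AN HONEST `ℚ`-SELMER CLASS, FOR EVERY odd `d_K`.**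
See the module docstring: `κ` is McCallum's class over `Γ_ℚ` of `θ⁻¹P(n)`; `res_K κ = c_M(n)`
(`map_cls`); Selmer at `v ∤ d_K` by (desc-fin), at `∞` by `Δ < 0`, at `q ∣ d_K` by the genus
triviality criterion with the involution input — the reason for the extra level of depth.
[cite: GrossLMS1991, Prop. 3.6, §4 (4.2)–(4.6), Prop. 5.4, Prop. 6.2 (1)] [cite: McCallumLMS1991, §4 (4)–(6), Lemma 4.1, 4.3]
[cite: MilneADT2006, Ch. I Prop. 3.8, §6] -/
theorem exists_selmer_resTorsion_eq_kolyvaginClass_two_of_sign_one (hΔ : W.Δ < 0)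
    (hsurj : W.HasSurjectiveModNGaloisRep ((2 : ℤ) ^ 1))
    (hK : IsImaginaryQuadratic K) (hodd : Odd (NumberField.discr K)) (h3 : NumberField.discr K ≠ -3)
    (hH : SatisfiesHeegnerHypothesis (W.conductorNorm ℤ) K)
    (Dt : ModularParametrizationData W (W.conductorNorm ℤ)) (β : ℤ) (ι : K →+* ℂ)
    {n M : ℕ} (hn : Squarefree n) (hM : 1 ≤ M)
    (hkol : ∀ q ∈ n.primeFactors, Zhang2014.IsKolyvaginPrime (W.conductorNorm ℤ) W K 2 q ∧
      M + 1 ≤ Zhang2014.kolyvaginIndex W 2 q)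
    (d : KolyvaginHeegnerData Dt β ι n) (hsign : -W.rootNumber * (-1) ^ n.primeFactors.card = 1)
    (hsel : ∀ w : HeightOneSpectrum (𝓞 K), d.kolyvaginClass Nat.prime_two M ∈
      selmerLocalKer (W.baseChange K) (w.adicCompletion K) ((2 ^ M : ℕ) : ℤ)) :
    ∃ κ : galH1Torsion W ((2 ^ M : ℕ) : ℤ),
      (∀ v : HeightOneSpectrum (𝓞 ℚ), κ ∈ selmerLocalKer W (v.adicCompletion ℚ) ((2 ^ M : ℕ) : ℤ)) ∧
      (∀ w : InfinitePlace ℚ, κ ∈ selmerLocalKer W w.Completion ((2 ^ M : ℕ) : ℤ)) ∧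
      resTorsion W K ((2 ^ M : ℕ) : ℤ) κ = d.kolyvaginClass Nat.prime_two M := by
  have hn0 : n ≠ 0 := hn.ne_zero
  have hkolM : ∀ q ∈ n.primeFactors, Zhang2014.IsKolyvaginPrime (W.conductorNorm ℤ) W K 2 q ∧
      M ≤ Zhang2014.kolyvaginIndex W 2 q := fun q hq ↦ ⟨(hkol q hq).1, by have := (hkol q hq).2; omega⟩
  have hM1 : 1 ≤ M + 1 := by omega
  have hAK : IsAdmissible (absoluteGaloisGroup K) d.pointsSubgroup ((2 ^ M : ℕ) : ℤ) :=
    GenusKoly.isAdmissible_pointsSubgroup_two hK hodd hH hsurj hn0 d M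
  have hAK1 : IsAdmissible (absoluteGaloisGroup K) d.pointsSubgroup ((2 ^ (M + 1) : ℕ) : ℤ) :=
    GenusKoly.isAdmissible_pointsSubgroup_two hK hodd hH hsurj hn0 d (M + 1)
  have hPK := toGeomPoints_derivedPoint_mem_invPoints_two hK hodd h3 hH Dt β ι hn hkolM d
  have hPK1 := toGeomPoints_derivedPoint_mem_invPoints_two hK hodd h3 hH Dt β ι hn hkol d
  set θ := RatClosure.pointsEquiv (K := K) W with hθdef
  set A : AddSubgroup W.geomPoints := d.pointsSubgroup.comap θ.toAddMonoidHom with hAdef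
  set P : W.geomPoints := θ.symm (d.toGeomPoints d.derivedPoint) with hPdef
  have hA : IsAdmissible (absoluteGaloisGroup ℚ) A ((2 ^ M : ℕ) : ℤ) :=
    isAdmissible_comap_pointsEquiv hK hn0 d hAK
  have hA1 : IsAdmissible (absoluteGaloisGroup ℚ) A ((2 ^ (M + 1) : ℕ) : ℤ) :=
    isAdmissible_comap_pointsEquiv hK hn0 d hAK1
  have h2n : (2 : ℤ) * ((2 ^ M : ℕ) : ℤ) = ((2 ^ (M + 1) : ℕ) : ℤ) := by push_cast; ring
  have hA2 : ∀ ⦃a : W.geomPoints⦄, a ∈ A → (2 * ((2 ^ M : ℕ) : ℤ)) • a = 0 → a = 0 :=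
    fun a ha h0 ↦ hA1.eq_zero_of_zsmul ha (by rwa [h2n] at h0)
  have hP : P ∈ invPoints (absoluteGaloisGroup ℚ) A ((2 ^ M : ℕ) : ℤ) :=
    mem_invPoints_comap_pointsEquiv hK d hPK fun c hc τ hτ ↦
      exists_pointsMap_derivedPoint_eq_add_two_pow_smul_of_sign_one hK hodd h3 hH hsurj Dt β ι hn hM hkolM d
        hsign hc hτ
  have hdeep : P ∈ invPoints (absoluteGaloisGroup ℚ) A (2 * ((2 ^ M : ℕ) : ℤ)) := by
    rw [h2n]
    exact mem_invPoints_comap_pointsEquiv hK d hPK1 fun c hc τ hτ ↦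
      exists_pointsMap_derivedPoint_eq_add_two_pow_smul_of_sign_one hK hodd h3 hH hsurj Dt β ι hn hM1 hkol d
        hsign hc hτ
  have hnz : ((2 ^ M : ℕ) : ℤ) ≠ 0 := by positivity
  have hdiv : ∀ X : W.geomPoints, ∃ Y : W.geomPoints, ((2 ^ M : ℕ) : ℤ) • Y = X :=
    W.zsmul_geomPoints_surjective_of_charZero hnz
  set κ := kolyvaginClass W ((2 ^ M : ℕ) : ℤ) hdiv hA P hP with hκdef
  have hres : resTorsion W K ((2 ^ M : ℕ) : ℤ) κ = d.kolyvaginClass Nat.prime_two M := by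
    have hQ := Classical.choose_spec (hdiv P)
    have hΨ : ∀ (h : absoluteGaloisGroup K) (m : W.geomPoints),
        (θ : W.geomPoints →+ geomPoints (W.baseChange K)) (resGal (K := ℚ) K h • m) =
          h • (θ : W.geomPoints →+ geomPoints (W.baseChange K)) m := fun h m ↦ by
      change θ (absGaloisRestrict ℚ K h • m) = h • θ m
      exact RatClosure.pointsEquiv_smul W h m
    have hψΨ : ∀ x : geomTorsion W ((2 ^ M : ℕ) : ℤ),
        (torsionBaseChangeMap W K ((2 ^ M : ℕ) : ℤ) x : geomPoints (W.baseChange K)) =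
          (θ : W.geomPoints →+ geomPoints (W.baseChange K)) x := fun x ↦ by
      rw [coe_torsionBaseChangeMap, localPointsEquivGeomPoints_pointsMap_eq_pointsEquiv]
      rfl
    have hAA' : ∀ a ∈ A, (θ : W.geomPoints →+ geomPoints (W.baseChange K)) a ∈ d.pointsSubgroup :=
      fun a ha ↦ ha
    have hθP : (θ : W.geomPoints →+ geomPoints (W.baseChange K)) P = d.toGeomPoints d.derivedPoint :=
      θ.apply_symm_apply _
    have hP' : (θ : W.geomPoints →+ geomPoints (W.baseChange K)) P ∈
        invPoints (absoluteGaloisGroup K) d.pointsSubgroup ((2 ^ M : ℕ) : ℤ) := by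
      rw [hθP]; exact hPK
    have hQ' : ((2 ^ M : ℕ) : ℤ) • (θ : W.geomPoints →+ geomPoints (W.baseChange K))
        (Classical.choose (hdiv P)) = (θ : W.geomPoints →+ geomPoints (W.baseChange K)) P := by
      rw [← map_zsmul, hQ]
    have hdivK : ∀ X : geomPoints (W.baseChange K), ∃ Y, ((2 ^ M : ℕ) : ℤ) • Y = X :=
      (W.baseChange K).zsmul_geomPoints_surjective_of_charZero hnz
    have hmap := map_cls (resGal (K := ℚ) K) (θ : W.geomPoints →+ geomPoints (W.baseChange K)) hΨ
      (torsionBaseChangeMap W K ((2 ^ M : ℕ) : ℤ)) hψΨ (torsionBaseChangeMap_smul W K _) hA hAK hAA'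
      (continuous_smul_geomPoints W) (continuous_smul_geomPoints (W.baseChange K)) hP hQ hP' hQ'
    rw [hκdef, kolyvaginClass_eq_cls hA hP hQ]
    change ContinuousCohomology.map (resGal (K := ℚ) K)
        (resHomOfEquivariant (resGal (K := ℚ) K) (torsionBaseChangeMap W K ((2 ^ M : ℕ) : ℤ))
          (torsionBaseChangeMap_smul W K _)) 1 (cls hA _ hP hQ) = _
    rw [hmap, d.kolyvaginClass_of_admissible Nat.prime_two M hAK hPK,
      kolyvaginClass_eq_cls (hdiv := hdivK) hAK hPK
        (Q := (θ : W.geomPoints →+ geomPoints (W.baseChange K)) (Classical.choose (hdiv P)))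
        (by rw [hQ', hθP])]
    exact cls_congr hAK _ hθP rfl
  refine ⟨κ, fun v ↦ ?_, fun w ↦ ?_, hres⟩
  · -- finite places
    by_cases hvd : ((primesEquiv v : ℕ) : ℤ) ∣ NumberField.discr K
    · -- a prime of `d_K`: the genus triviality criterion
      haveI hqF : Fact (primesEquiv v : ℕ).Prime := ⟨(primesEquiv v).2⟩
      have hq2 : (primesEquiv v : ℕ) ≠ 2 := fun h ↦ by
        rw [h] at hvd
        exact (Int.not_even_iff_odd.mpr hodd) (even_iff_two_dvd.mpr (by exact_mod_cast hvd))
      have hqn : ¬ (primesEquiv v : ℕ) ∣ 2 ^ M := fun h ↦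
        hq2 ((Nat.prime_dvd_prime_iff_eq hqF.out Nat.prime_two).mp (hqF.out.dvd_of_dvd_pow h))
      have hqN : ¬ (primesEquiv v : ℕ) ∣ W.conductorNorm ℤ := fun h ↦ by
        have hcop := GenusKoly.heegner_isCoprime_conductorNorm_discr (W := W) hK hH
        have hu := hcop.isUnit_of_dvd' (Int.natCast_dvd_natCast.mpr h) hvd
        rw [Int.isUnit_iff] at hu
        rcases hu with hu | hu
        · exact hqF.out.one_lt.ne' (by exact_mod_cast hu)
        · have : (0 : ℤ) ≤ ((primesEquiv v : ℕ) : ℤ) := by positivity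
          omega
      have hgoodP : W.HasGoodReductionAtPrime (primesEquiv v : ℕ) := by
        by_contra h
        exact hqN ((W.dvd_conductorNorm_iff_not_hasGoodReductionAtPrime (primesEquiv v : ℕ)).mpr h)
      have hgood : W.HasGoodReductionAt v := by
        by_contra h; exact hqN ((W.dvd_conductorNorm_iff v).mpr h)
      have hΔq : ¬ ((primesEquiv v : ℕ) : ℤ) ∣ minimalDiscriminantInt W :=
        W.not_dvd_minimalDiscriminantInt_of_hasGoodReductionAtPrime' (primesEquiv v : ℕ) hgoodP
      have hqn' : ¬ (primesEquiv v : ℕ) ∣ n := fun h ↦ by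
        have hqmem : (primesEquiv v : ℕ) ∈ n.primeFactors := Nat.mem_primeFactors.mpr ⟨hqF.out, h, hn0⟩
        exact (hkol _ hqmem).1.2.2.1 hvd
      refine kolyvaginClass_mem_selmerLocalKer_of_sq_of_deep W hΔq rfl hgood hqn hA hA2 hP hdeep ?_
      intro 𝔓 h𝔓 g hg
      exact smul_smul_pointsEquiv_symm_toGeomPoints_eq_of_mem_inertia W hK hn0 d hqF.out hqn' rfl h𝔓 hg
        d.derivedPoint
    · -- off `d_K`: (desc-fin)
      exact hdescfin_of_not_dvd_discr hK hH _ _ v hvd fun w _ ↦ by rw [hres]; exact hsel w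
  · -- the real place: `Δ < 0`
    rw [WeierstrassCurve.mem_selmerLocalKer_iff_torsionH1ToH1_mem,
      GenusExact.ArchVanishing.localRestrictionKer_infinitePlace_eq_top_of_Δ_neg W w hΔ]
    exact AddSubgroup.mem_top _

end Main

end Summit.BirchSwinnertonDyer.BirchSwinnertonDyer.Theorems.KolyvaginGenusTwo

end
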